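import Mathlib.LinearAlgebra.FreeModule.PID
import Mathlib.LinearAlgebra.FreeModule.Finite.Matrix
import Mathlib.LinearAlgebra.FreeModule.Finite.Quotient
import Mathlib.LinearAlgebra.Quotient.Basic
import Mathlib.LinearAlgebra.Dimension.Finrank
import Mathlib.LinearAlgebra.FiniteDimensional.Defs
import Mathlib.LinearAlgebra.BilinearForm.Basic
import Mathlib.RingTheory.Localization.Module

/-!
# Route LinearSystemTorelli — crux `LocalTubeSpan` (stmt-HodgeConjecture-2490): the shear lattice

Helper file (`--supports stmt-HodgeConjecture-2490`, line `Sketch` of the crux chain, cycle 6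
"Schnell's Lemma 11 for degenerate skew vanishing lattices from the nondegenerate case", stub
`stub_shearLattice`).  For a (possibly degenerate) bilinear form `B` on a finite-dimensional
`ℚ`-space `V` with radical `R = ker B`, the elements of the monodromy group acting trivially on
`V / R` are the SHEARS `x ↦ x + φ x` with `φ` an endomorphism such that `im φ ⊆ R ⊆ ker φ`; those
preserving the lattice `Λ = ℤΔ` correspond to the `φ` with `φ Λ ⊆ Λ`.  This file proves the pure
linear algebra the frame lift needs about them:

* `localTubeSpan_shearLattice` — for a finitely generated `ℤ`-submodule `Λ` spanning `V` over `ℚ`,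
  the endomorphisms `φ` with `im φ ⊆ ker B`, `ker B ⊆ ker φ` and `φ Λ ⊆ Λ` form a `ℤ`-submodule `N`
  of `End_ℚ V` which is finitely generated and free of rank at most
  `dim (V / ker B) · dim (ker B)`.

Proof: restriction to `Λ` embeds `N` into `End_ℤ Λ` (injective because `Λ` spans `V`), a finitely
generated `ℤ`-module since `Λ` is finitely generated and torsion-free, hence free; so `N` is
finitely generated, and free being torsion-free inside a `ℚ`-space.  A `ℤ`-basis of `N` is
`ℤ`-independent, hence `ℚ`-independent (`ℚ = Frac ℤ`), inside the `ℚ`-subspace of all `φ` with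
`im φ ⊆ ker B ⊆ ker φ`, which is the image of `Hom(V / ker B, ker B)` under
`ψ ↦ (ker B ↪ V) ∘ ψ ∘ (V ↠ V / ker B)`; its dimension is therefore at most
`dim (V / ker B) · dim (ker B)`.  Pure linear algebra over Mathlib; no named facts.
-/

-- `Summit.HodgeConjecture.HodgeConjecture.Theorems` is the mandated namespace (single-conjunct summit:
-- Sub = Summit), which `linter.dupNamespace` flags on every declaration; the lakefile turns the
-- linter off tree-wide (weak option), restated here so stand-alone elaboration is warning-free too.
set_option linter.dupNamespace false

noncomputable section

namespace Summit.HodgeConjecture.HodgeConjecture.Theorems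

section ShearLattice

/-- A finitely generated free `ℤ`-submodule `N` of a `ℚ`-vector space `W` contained in a
finite-dimensional `ℚ`-subspace `E` has `ℤ`-rank at most `dim_ℚ E`: a `ℤ`-basis of `N` is
`ℤ`-linearly independent in `W`, hence `ℚ`-linearly independent (`ℚ` is the fraction field of
`ℤ`), and it lies in `E`. [folklore] -/
theorem localTubeSpan_finrank_int_le_finrank_rat {W : Type*} [AddCommGroup W] [Module ℚ W]
    (E : Submodule ℚ W) [Module.Finite ℚ E] (N : Submodule ℤ W) (hNE : ∀ x ∈ N, x ∈ E)
    [Module.Free ℤ N] [Module.Finite ℤ N] :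
    Module.finrank ℤ N ≤ Module.finrank ℚ E := by
  classical
  let b := Module.Free.chooseBasis ℤ N
  rw [Module.finrank_eq_card_chooseBasisIndex]
  -- the basis vectors, viewed in `W`, are `ℤ`-independent, hence `ℚ`-independent
  have hbZ : LinearIndependent ℤ (fun i => ((b i : N) : W)) :=
    b.linearIndependent.map' N.subtype (Submodule.ker_subtype N)
  have hbQ : LinearIndependent ℚ (fun i => ((b i : N) : W)) :=
    (LinearIndependent.iff_fractionRing ℤ ℚ).mp hbZ
  -- and they lie in `E`
  let w : Module.Free.ChooseBasisIndex ℤ N → E := fun i => ⟨((b i : N) : W), hNE _ (b i).2⟩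
  have hw : LinearIndependent ℚ w := LinearIndependent.of_comp E.subtype hbQ
  exact hw.fintype_card_le_finrank

/-- For a subspace `R` of a finite-dimensional `ℚ`-space `V`, the endomorphisms `φ` of `V` with
`im φ ⊆ R` and `R ⊆ ker φ` all lie in a `ℚ`-subspace `E` of `End V` of dimension at most
`dim (V / R) · dim R` — namely the range of `Hom(V / R, R) → End V`,
`ψ ↦ (R ↪ V) ∘ ψ ∘ (V ↠ V / R)`: such a `φ` is the image of the map `V / R → R` it induces.
[folklore] -/
theorem localTubeSpan_exists_subspace_of_shears {V : Type} [AddCommGroup V] [Module ℚ V]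
    [FiniteDimensional ℚ V] (R : Submodule ℚ V) :
    ∃ E : Submodule ℚ (V →ₗ[ℚ] V),
      (∀ φ : V →ₗ[ℚ] V, (∀ x, φ x ∈ R) → (∀ r ∈ R, φ r = 0) → φ ∈ E) ∧
      Module.finrank ℚ E ≤ Module.finrank ℚ (V ⧸ R) * Module.finrank ℚ R := by
  -- `Φ ψ = (R ↪ V) ∘ ψ ∘ (V ↠ V / R)`
  let Φ : ((V ⧸ R) →ₗ[ℚ] R) →ₗ[ℚ] (V →ₗ[ℚ] V) :=
    { toFun := fun ψ => R.subtype ∘ₗ ψ ∘ₗ R.mkQ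
      map_add' := fun ψ₁ ψ₂ => by
        ext x
        simp only [LinearMap.comp_apply, LinearMap.add_apply, map_add]
      map_smul' := fun c ψ => by
        ext x
        simp only [LinearMap.comp_apply, LinearMap.smul_apply, map_smul, RingHom.id_apply] }
  refine ⟨LinearMap.range Φ, fun φ h1 h2 => ?_, ?_⟩
  · -- `φ` factors as `Φ ψ` with `ψ` induced on the quotient by the corestriction of `φ` to `R`
    have hker : R ≤ LinearMap.ker (LinearMap.codRestrict R φ h1) := by
      intro r hr
      rw [LinearMap.mem_ker]
      ext
      rw [LinearMap.codRestrict_apply, h2 r hr, Submodule.coe_zero]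
    refine ⟨R.liftQ (LinearMap.codRestrict R φ h1) hker, ?_⟩
    ext x
    simp only [Φ, LinearMap.coe_mk, AddHom.coe_mk, LinearMap.comp_apply, Submodule.mkQ_apply,
      Submodule.liftQ_apply, LinearMap.codRestrict_apply, Submodule.subtype_apply]
  · calc Module.finrank ℚ (LinearMap.range Φ)
        ≤ Module.finrank ℚ ((V ⧸ R) →ₗ[ℚ] R) := LinearMap.finrank_range_le Φ
      _ = Module.finrank ℚ (V ⧸ R) * Module.finrank ℚ R := Module.finrank_linearMap ℚ ℚ (V ⧸ R) R

/-- **The shear lattice.**  For a finitely generated `ℤ`-submodule `Λ` spanning the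
finite-dimensional `ℚ`-space `V` and a bilinear form `B` on `V` with radical `ker B`, the
endomorphisms `φ` with `im φ ⊆ ker B ⊆ ker φ` that preserve `Λ` form a finitely generated free
`ℤ`-module `N` of rank at most `dim (V / ker B) · dim (ker B)`: restriction embeds `N` in
`End_ℤ Λ` since `Λ` spans `V`, and `ℤ`-independent elements of `N` are `ℚ`-independent in the
`ℚ`-space `{φ | im φ ⊆ ker B ⊆ ker φ} ≅ Hom(V / ker B, ker B)`. [folklore] -/
theorem localTubeSpan_shearLattice {V : Type} [AddCommGroup V] [Module ℚ V] [FiniteDimensional ℚ V]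
    (B : LinearMap.BilinForm ℚ V)
    (Λ : Submodule ℤ V) (hΛ : Λ.FG) (hΛspan : Submodule.span ℚ (Λ : Set V) = ⊤) :
    ∃ N : Submodule ℤ (V →ₗ[ℚ] V),
      (∀ φ : V →ₗ[ℚ] V, φ ∈ N ↔
        ((∀ x, φ x ∈ LinearMap.ker B) ∧ (∀ r ∈ LinearMap.ker B, φ r = 0) ∧
          ∀ x ∈ Λ, φ x ∈ Λ)) ∧
      N.FG ∧ Module.Free ℤ N ∧
      Module.finrank ℤ N ≤
        Module.finrank ℚ (V ⧸ LinearMap.ker B) * Module.finrank ℚ (LinearMap.ker B) := by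
  set R : Submodule ℚ V := LinearMap.ker B
  -- the `ℤ`-submodule of lattice-preserving shears
  let N : Submodule ℤ (V →ₗ[ℚ] V) :=
    { carrier := {φ | (∀ x, φ x ∈ R) ∧ (∀ r ∈ R, φ r = 0) ∧ ∀ x ∈ Λ, φ x ∈ Λ}
      add_mem' := fun {φ ψ} hφ hψ =>
        ⟨fun x => by simpa only [LinearMap.add_apply] using R.add_mem (hφ.1 x) (hψ.1 x),
          fun r hr => by simp only [LinearMap.add_apply, hφ.2.1 r hr, hψ.2.1 r hr, add_zero],
          fun x hx => by
            simpa only [LinearMap.add_apply] using Λ.add_mem (hφ.2.2 x hx) (hψ.2.2 x hx)⟩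
      zero_mem' := ⟨fun x => R.zero_mem, fun r _ => rfl, fun x _ => Λ.zero_mem⟩
      smul_mem' := fun c φ hφ =>
        ⟨fun x => by simpa only [LinearMap.smul_apply] using R.smul_of_tower_mem c (hφ.1 x),
          fun r hr => by simp only [LinearMap.smul_apply, hφ.2.1 r hr, smul_zero],
          fun x hx => by simpa only [LinearMap.smul_apply] using Λ.smul_mem c (hφ.2.2 x hx)⟩ }
  have hmem : ∀ φ : V →ₗ[ℚ] V, φ ∈ N ↔
      ((∀ x, φ x ∈ R) ∧ (∀ r ∈ R, φ r = 0) ∧ ∀ x ∈ Λ, φ x ∈ Λ) := fun φ => Iff.rfl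
  -- torsion-freeness: `V` and `End V` are `ℚ`-spaces
  have hV : IsAddTorsionFree V := IsAddTorsionFree.of_module_rat V
  have hEnd : IsAddTorsionFree (V →ₗ[ℚ] V) := IsAddTorsionFree.of_module_rat (V →ₗ[ℚ] V)
  -- `Λ` is finitely generated and torsion-free, hence free, so `End_ℤ Λ` is finitely generated
  have hΛfin : Module.Finite ℤ Λ := Module.Finite.iff_fg.mpr hΛ
  -- restriction to `Λ`
  let res : N →ₗ[ℤ] (Λ →ₗ[ℤ] Λ) :=
    { toFun := fun φ => ((φ : V →ₗ[ℚ] V).restrictScalars ℤ).restrict fun x hx => φ.2.2.2 x hx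
      map_add' := fun φ ψ => by
        ext x
        rfl
      map_smul' := fun c φ => by
        ext x
        rfl }
  have hres : Function.Injective res := by
    rw [injective_iff_map_eq_zero]
    intro φ hφ
    have hφΛ : ∀ x ∈ Λ, (φ : V →ₗ[ℚ] V) x = 0 := fun x hx => by
      have := congrArg Subtype.val (LinearMap.congr_fun hφ ⟨x, hx⟩)
      simpa only [res, LinearMap.coe_mk, AddHom.coe_mk, LinearMap.restrict_apply,
        LinearMap.restrictScalars_apply, LinearMap.zero_apply, Submodule.coe_zero] using this
    have hker : (⊤ : Submodule ℚ V) ≤ LinearMap.ker (φ : V →ₗ[ℚ] V) := by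
      rw [← hΛspan, Submodule.span_le]
      intro x hx
      exact hφΛ x hx
    ext x
    exact hker (Submodule.mem_top (x := x))
  have hNfin : Module.Finite ℤ N := Module.Finite.of_injective res hres
  -- the `ℚ`-subspace of all shears bounds the rank
  obtain ⟨E, hNE, hE⟩ := localTubeSpan_exists_subspace_of_shears R
  refine ⟨N, hmem, Module.Finite.iff_fg.mp hNfin, inferInstance, ?_⟩
  calc Module.finrank ℤ N
      ≤ Module.finrank ℚ E :=
        localTubeSpan_finrank_int_le_finrank_rat E N (fun φ hφ => hNE φ hφ.1 hφ.2.1)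
    _ ≤ Module.finrank ℚ (V ⧸ R) * Module.finrank ℚ R := hE

end ShearLattice

end Summit.HodgeConjecture.HodgeConjecture.Theorems

end
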